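import Summits.HodgeConjecture.CorCM.IrreducibleOddWeightsSubfamilyDominationClass
import Summits.HodgeConjecture.CorCM.IrreducibleOddWeightsCommutantDominationCMFields
import HarnessLib

/-!
# Sub-family domination, IV-CM: SUB-PRODUCTS OF CM ABELIAN VARIETIES — `dim MT(∏_I A_i) = dim MT(∏_T A_i)` IFF every
# `MC_i ≤ MC_T`; the exact two-block defect; in one isotypic class `cmFamilyRank·δ = δ + dim(⨆_i D⟨b^i⟩)·dim A`

COR-CM (cell `pub-hodgecm2`, binder seat `b16` gen 74, count-neutral claim SUB-FAMILY DOMINATION AND HODGE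
EQUIVALENCE, file S4-CM — the CM dress of files S1 `…SubfamilyDomination` and S4 `…SubfamilyDominationClass`
(`G = Aut(ℂ)`, slots `Hom(K_i, ℂ)`, sub-families `T ⊆ I` as `Finset`s); theorems only, no definition, no named fact,
no `sorry`).  NEW as stated, hence under `Summits/`.  HONEST FRAMING: statements about `cmFamilyRank Φ|_T =
dim MT(∏_{i∈T} A_i)` (tree) and the matrix-coefficient spaces `MC_i ≤ ℚ^{Aut(ℂ)}` (`= X^*(MT(A_i))_ℚ`, gen 64 R1/R2),
`MC_T = ⨆_{i∈T} MC_i`; gen 56 `…RestrictionCMFields` / `…Submodular` give `cmFamilyRank Φ|_T ≤ cmFamilyRank Φ`,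
submodularity and the equivariant-generation criterion — imported, not restated.  Nothing is claimed about the
algebraicity of Hodge classes; `HC_CM` is neither used nor asserted.

* §1 **`cmFamilyRank_restrict_add_finrank_iSup_eq`** (`cmFamilyRank Φ|_T + dim MC_I = cmFamilyRank Φ + dim MC_T`),
  **`cmFamilyRank_eq_restrict_iff_forall_span_coeff_le`** (`dim MT(∏_I A_i) = dim MT(∏_T A_i) ⟺ ∀ i, MC_i ≤ MC_T`:
  every factor HODGE-DOMINATED by the sub-product), two blocks **`cmFamilyRank_add_cmFamilyRank_eq_of_union`**
  (`cmFamilyRank Φ|_S + cmFamilyRank Φ|_T = cmFamilyRank Φ|_{S∪T} + 1 + dim(MC_S ∩ MC_T)`), additive iff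
  `MC_S ∩ MC_T = 0`, `cmFamilyRank_union_eq_iff_iSup_span_coeff_le`; one more factor
  **`cmFamilyRank_insert_add_one_add_finrank_inf_eq`**, **`cmFamilyRank_insert_eq_iff_span_coeff_le`**
  (`dim MT(∏_{T∪{i}} A) = dim MT(∏_T A) ⟺ MC_i ≤ MC_T`); all but one `cmFamilyRank_add_one_add_finrank_inf_eq_erase`,
  `cmFamilyRank_eq_erase_iff_span_coeff_le`.
* §2 IN ONE ISOTYPIC CLASS (every `u_i = Σ_j ι^i_j(b^i_j)` from one reference `Aut(ℂ)`-stable irreducible `A ≤ ℚ^Y`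
  with commutant `𝒟`, ANY): **`cmFamilyRank_mul_eq_of_commutant`** (`dim MT(∏_i A_i)·δ = δ + dim(⨆_i D⟨b^i⟩)·dim A`),
  `cmFamilyRank_add_card_mul_add_eq_of_commutant` (family defect), **`cmFamilyRank_add_card_eq_iff_iSupIndep_of_commutant`**
  (`Hg(∏_i A_i) = ∏_i Hg(A_i) ⟺` the `D⟨b^i⟩` are independent), **`cmFamilyRank_eq_restrict_iff_forall_iSup_le_of_commutant`**
  (`⟺ ∀ i, D⟨b^i⟩ ≤ ⨆_{j∈T} D⟨b^j⟩`), `cmFamilyRank_eq_erase_iff_iSup_le_of_commutant`.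

## References

* [Deligne1982HodgeCycles] P. Deligne, *Hodge cycles on abelian varieties*, LNM 900 (1982), I.5 (p. 53), I Ex. 3.7.
* [Gordon1999HodgeAVSurvey] B. B. Gordon, *A survey of the Hodge conjecture for abelian varieties*, §3 Theorem (Imai,
  Murty) with proof, 7.5–7.7, 9.1, 9.4.3.
* [Lang2002] S. Lang, *Algebra*, 3rd ed., XVII §1 and §3.
* [Ribet1980] K. A. Ribet, *Division fields of abelian varieties with complex multiplication*, Mém. SMF 2 (1980),
  §3 (3.3).
-/

set_option autoImplicit false

noncomputable section

open scoped BigOperators Classical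

universe vY

namespace Summit.HodgeConjecture.CorCM

open CategoryTheory CategoryTheory.Limits NumberField Module IntermediateField
open Literature.NumberTheory.ComplexMultiplication
open Literature.AlgebraicGeometry.Motives (AbelianVariety CMType)
open Literature.AlgebraicGeometry.Motives.AbelianVariety
open Literature.AlgebraicGeometry.HodgeTheory
open Literature.AlgebraicGeometry.ComplexMultiplication (IsCMTypeRealisation)
open Literature.AlgebraicGeometry.Pohlmann1968

variable {I : Type} [Fintype I] {K : I → Type} [∀ i, Field (K i)] [∀ i, NumberField (K i)] [∀ i, IsCMField (K i)]
  {Y : Type vY} [MulAction (ℂ ≃+* ℂ) Y] [Fintype Y]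

/-! ### §1 Sub-products in the matrix-coefficient currency -/

/-- **THE SUB-PRODUCT EXCESS: `cmFamilyRank Φ|_T + dim MC_I = cmFamilyRank Φ + dim MC_T`** (`T ≠ ∅`), i.e.
`dim MT(∏_I A_i) − dim MT(∏_T A_i) = dim MC_I − dim MC_T`. [cite: Deligne1982HodgeCycles, I.5 (p. 53) and I Ex. 3.7
(c)] [cite: Ribet1980, §3 (3.3)] -/
theorem cmFamilyRank_restrict_add_finrank_iSup_eq (Φ : ∀ i, CMType (K i)) (T : Finset I) (hT : T.Nonempty) :
    CMAlgebra.cmFamilyRank (fun j : T => Φ j.1) +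
        Module.finrank ℚ ↥(⨆ i, Submodule.span ℚ (Set.range fun x : K i →+* ℂ => fun g : ℂ ≃+* ℂ =>
          antiVec (Φ i).1 g x)) =
      CMAlgebra.cmFamilyRank Φ +
        Module.finrank ℚ ↥(⨆ j : T, Submodule.span ℚ (Set.range fun x : K j.1 →+* ℂ => fun g : ℂ ≃+* ℂ =>
          antiVec (Φ j.1).1 g x)) := by
  obtain ⟨j₁, hj₁⟩ := hT
  obtain ⟨s₁⟩ : Nonempty (K j₁ →+* ℂ) := inferInstance
  haveI : Nonempty (Σ j : {j // j ∈ T}, (K j.1 →+* ℂ)) := ⟨⟨⟨j₁, hj₁⟩, s₁⟩⟩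
  exact IrrOdd.typeRank_sigmaType_reindex_add_finrank_iSup_eq (G := ℂ ≃+* ℂ) (E := fun i => K i →+* ℂ)
    (Φ := fun i => (Φ i).1) (fun i => isCMTypeWith_conj (Φ i)) (Subtype.val : {j // j ∈ T} → I)

/-- **SUB-PRODUCT DOMINATION: `cmFamilyRank Φ = cmFamilyRank Φ|_T ⟺ ∀ i, MC_i ≤ MC_T`** (`T ≠ ∅`) — `MT(∏_I A_i) →
MT(∏_T A_i)` is an isogeny iff every `X^*(MT(A_i))_ℚ` lies in `X^*(MT(∏_T A_i))_ℚ` (every factor is Hodge-dominated by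
the sub-product; gen 56: iff the type vectors are equivariantly generated by those in `T`).
[cite: Deligne1982HodgeCycles, I.5 (p. 53)] [cite: Gordon1999HodgeAVSurvey, §3 Theorem (proof), 7.7] -/
theorem cmFamilyRank_eq_restrict_iff_forall_span_coeff_le (Φ : ∀ i, CMType (K i)) (T : Finset I) (hT : T.Nonempty) :
    CMAlgebra.cmFamilyRank Φ = CMAlgebra.cmFamilyRank (fun j : T => Φ j.1) ↔
      ∀ i, Submodule.span ℚ (Set.range fun x : K i →+* ℂ => fun g : ℂ ≃+* ℂ => antiVec (Φ i).1 g x) ≤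
        ⨆ j : T, Submodule.span ℚ (Set.range fun x : K j.1 →+* ℂ => fun g : ℂ ≃+* ℂ => antiVec (Φ j.1).1 g x) := by
  obtain ⟨j₁, hj₁⟩ := hT
  obtain ⟨s₁⟩ : Nonempty (K j₁ →+* ℂ) := inferInstance
  haveI : Nonempty (Σ j : {j // j ∈ T}, (K j.1 →+* ℂ)) := ⟨⟨⟨j₁, hj₁⟩, s₁⟩⟩
  exact IrrOdd.typeRank_sigmaType_eq_reindex_iff_forall_span_coeff_le (G := ℂ ≃+* ℂ) (E := fun i => K i →+* ℂ)
    (Φ := fun i => (Φ i).1) (fun i => isCMTypeWith_conj (Φ i)) (Subtype.val : {j // j ∈ T} → I)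

/-- **THE EXACT TWO-BLOCK DEFECT (CM fields): `cmFamilyRank Φ|_S + cmFamilyRank Φ|_T = cmFamilyRank Φ|_{S∪T} + 1 +
dim(MC_S ∩ MC_T)`** (`S, T ≠ ∅`), i.e. `dim Hg(∏_S A_i) + dim Hg(∏_T A_i) − dim Hg(∏_{S∪T} A_i) = dim(MC_S ∩ MC_T)`.
[cite: Deligne1982HodgeCycles, I.5 (p. 53) and I Ex. 3.7 (c)] [cite: Gordon1999HodgeAVSurvey, §3 Theorem (proof),
7.5–7.7, 9.1] -/
theorem cmFamilyRank_add_cmFamilyRank_eq_of_union (Φ : ∀ i, CMType (K i)) (S T : Finset I) (hS : S.Nonempty)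
    (hT : T.Nonempty) :
    CMAlgebra.cmFamilyRank (fun j : S => Φ j.1) + CMAlgebra.cmFamilyRank (fun j : T => Φ j.1) =
      CMAlgebra.cmFamilyRank (fun j : ↥(S ∪ T) => Φ j.1) + 1 +
        Module.finrank ℚ
          ↥((⨆ j : S, Submodule.span ℚ (Set.range fun x : K j.1 →+* ℂ => fun g : ℂ ≃+* ℂ => antiVec (Φ j.1).1 g x)) ⊓
            ⨆ j : T, Submodule.span ℚ (Set.range fun x : K j.1 →+* ℂ => fun g : ℂ ≃+* ℂ => antiVec (Φ j.1).1 g x)) := by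
  obtain ⟨j₁, hj₁⟩ := hS
  obtain ⟨j₂, hj₂⟩ := hT
  obtain ⟨s₁⟩ : Nonempty (K j₁ →+* ℂ) := inferInstance
  obtain ⟨s₂⟩ : Nonempty (K j₂ →+* ℂ) := inferInstance
  haveI : Nonempty (Σ j : {j // j ∈ S}, (K j.1 →+* ℂ)) := ⟨⟨⟨j₁, hj₁⟩, s₁⟩⟩
  haveI : Nonempty (Σ j : {j // j ∈ T}, (K j.1 →+* ℂ)) := ⟨⟨⟨j₂, hj₂⟩, s₂⟩⟩
  exact IrrOdd.typeRank_sigmaType_add_typeRank_sigmaType_eq_of_union (G := ℂ ≃+* ℂ) (E := fun i => K i →+* ℂ)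
    (Φ := fun i => (Φ i).1) (fun i => isCMTypeWith_conj (Φ i)) (· ∈ S) (· ∈ T) (· ∈ S ∪ T)
    (fun i => by rw [Finset.mem_union])

/-- **Two sub-products are additive — `Hg(∏_{S∪T} A_i) = Hg(∏_S A_i) × Hg(∏_T A_i)` — iff `MC_S ∩ MC_T = 0`.**
[cite: Gordon1999HodgeAVSurvey, §3 Theorem and 7.5–7.7] [cite: Deligne1982HodgeCycles, I.5 (p. 53)] -/
theorem cmFamilyRank_add_cmFamilyRank_eq_add_one_iff_of_union (Φ : ∀ i, CMType (K i)) (S T : Finset I)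
    (hS : S.Nonempty) (hT : T.Nonempty) :
    CMAlgebra.cmFamilyRank (fun j : S => Φ j.1) + CMAlgebra.cmFamilyRank (fun j : T => Φ j.1) =
        CMAlgebra.cmFamilyRank (fun j : ↥(S ∪ T) => Φ j.1) + 1 ↔
      (⨆ j : S, Submodule.span ℚ (Set.range fun x : K j.1 →+* ℂ => fun g : ℂ ≃+* ℂ => antiVec (Φ j.1).1 g x)) ⊓
          (⨆ j : T, Submodule.span ℚ (Set.range fun x : K j.1 →+* ℂ => fun g : ℂ ≃+* ℂ => antiVec (Φ j.1).1 g x)) =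
        ⊥ := by
  obtain ⟨j₁, hj₁⟩ := hS
  obtain ⟨j₂, hj₂⟩ := hT
  obtain ⟨s₁⟩ : Nonempty (K j₁ →+* ℂ) := inferInstance
  obtain ⟨s₂⟩ : Nonempty (K j₂ →+* ℂ) := inferInstance
  haveI : Nonempty (Σ j : {j // j ∈ S}, (K j.1 →+* ℂ)) := ⟨⟨⟨j₁, hj₁⟩, s₁⟩⟩
  haveI : Nonempty (Σ j : {j // j ∈ T}, (K j.1 →+* ℂ)) := ⟨⟨⟨j₂, hj₂⟩, s₂⟩⟩
  exact IrrOdd.typeRank_sigmaType_add_typeRank_sigmaType_eq_add_one_iff_of_union (G := ℂ ≃+* ℂ)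
    (E := fun i => K i →+* ℂ) (Φ := fun i => (Φ i).1) (fun i => isCMTypeWith_conj (Φ i)) (· ∈ S) (· ∈ T) (· ∈ S ∪ T)
    (fun i => by rw [Finset.mem_union])

/-- **`cmFamilyRank Φ|_{S∪T} = cmFamilyRank Φ|_S ⟺ MC_T ≤ MC_S`** (`S ≠ ∅`): the block `∏_T A_i` is Hodge-dominated by
`∏_S A_i`. [cite: Deligne1982HodgeCycles, I.5 (p. 53)] [cite: Gordon1999HodgeAVSurvey, §3 Theorem (proof), 7.7] -/
theorem cmFamilyRank_union_eq_iff_iSup_span_coeff_le (Φ : ∀ i, CMType (K i)) (S T : Finset I) (hS : S.Nonempty) :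
    CMAlgebra.cmFamilyRank (fun j : ↥(S ∪ T) => Φ j.1) = CMAlgebra.cmFamilyRank (fun j : S => Φ j.1) ↔
      (⨆ j : T, Submodule.span ℚ (Set.range fun x : K j.1 →+* ℂ => fun g : ℂ ≃+* ℂ => antiVec (Φ j.1).1 g x)) ≤
        ⨆ j : S, Submodule.span ℚ (Set.range fun x : K j.1 →+* ℂ => fun g : ℂ ≃+* ℂ => antiVec (Φ j.1).1 g x) := by
  obtain ⟨j₁, hj₁⟩ := hS
  obtain ⟨s₁⟩ : Nonempty (K j₁ →+* ℂ) := inferInstance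
  haveI : Nonempty (Σ j : {j // j ∈ S}, (K j.1 →+* ℂ)) := ⟨⟨⟨j₁, hj₁⟩, s₁⟩⟩
  exact IrrOdd.typeRank_sigmaType_eq_iff_iSup_span_coeff_le_of_union (G := ℂ ≃+* ℂ) (E := fun i => K i →+* ℂ)
    (Φ := fun i => (Φ i).1) (fun i => isCMTypeWith_conj (Φ i)) (· ∈ S) (· ∈ T) (· ∈ S ∪ T)
    (fun i => by rw [Finset.mem_union])

/-- **ONE MORE FACTOR: `cmFamilyRank Φ|_{T∪{i}} + 1 + dim(MC_T ∩ MC_i) = cmFamilyRank Φ|_T + cmTypeRank Φ_i`** (`T ≠ ∅`) —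
`A_i` adds `dim Hg(A_i) − dim(MC_T ∩ MC_i)` to the Hodge group of `∏_T A_j`. [cite: Deligne1982HodgeCycles, I.5
(p. 53)] [cite: Gordon1999HodgeAVSurvey, §3 Theorem (proof), 7.5–7.7, 9.1] -/
theorem cmFamilyRank_insert_add_one_add_finrank_inf_eq (Φ : ∀ i, CMType (K i)) (T : Finset I) (hT : T.Nonempty)
    (i : I) :
    CMAlgebra.cmFamilyRank (fun j : ↥(insert i T) => Φ j.1) + 1 +
        Module.finrank ℚ
          ↥((⨆ j : T, Submodule.span ℚ (Set.range fun x : K j.1 →+* ℂ => fun g : ℂ ≃+* ℂ => antiVec (Φ j.1).1 g x)) ⊓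
            Submodule.span ℚ (Set.range fun x : K i →+* ℂ => fun g : ℂ ≃+* ℂ => antiVec (Φ i).1 g x)) =
      CMAlgebra.cmFamilyRank (fun j : T => Φ j.1) + cmTypeRank (Φ i) := by
  obtain ⟨j₁, hj₁⟩ := hT
  obtain ⟨s₁⟩ : Nonempty (K j₁ →+* ℂ) := inferInstance
  haveI : Nonempty (Σ j : {j // j ∈ T}, (K j.1 →+* ℂ)) := ⟨⟨⟨j₁, hj₁⟩, s₁⟩⟩
  exact IrrOdd.typeRank_sigmaType_add_one_add_finrank_inf_eq_of_insert (G := ℂ ≃+* ℂ) (E := fun i => K i →+* ℂ)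
    (Φ := fun i => (Φ i).1) (fun i => isCMTypeWith_conj (Φ i)) (· ∈ T) (· ∈ insert i T)
    (fun j => by rw [Finset.mem_insert]; exact Or.comm)

/-- **`cmFamilyRank Φ|_{T∪{i}} = cmFamilyRank Φ|_T ⟺ MC_i ≤ MC_T`** (`T ≠ ∅`): the new factor adds NOTHING to the
Mumford–Tate group iff `X^*(MT(A_i))_ℚ ⊆ X^*(MT(∏_T A_j))_ℚ` (gen 56 `cmFamilyRank_insert_eq_iff`: iff `u_i` is an
equivariant combination of the `u_j`, `j ∈ T`). [cite: Deligne1982HodgeCycles, I.5 (p. 53)]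
[cite: Gordon1999HodgeAVSurvey, §3 Theorem (proof), 7.7] -/
theorem cmFamilyRank_insert_eq_iff_span_coeff_le (Φ : ∀ i, CMType (K i)) (T : Finset I) (hT : T.Nonempty) (i : I) :
    CMAlgebra.cmFamilyRank (fun j : ↥(insert i T) => Φ j.1) = CMAlgebra.cmFamilyRank (fun j : T => Φ j.1) ↔
      Submodule.span ℚ (Set.range fun x : K i →+* ℂ => fun g : ℂ ≃+* ℂ => antiVec (Φ i).1 g x) ≤
        ⨆ j : T, Submodule.span ℚ (Set.range fun x : K j.1 →+* ℂ => fun g : ℂ ≃+* ℂ => antiVec (Φ j.1).1 g x) := by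
  obtain ⟨j₁, hj₁⟩ := hT
  obtain ⟨s₁⟩ : Nonempty (K j₁ →+* ℂ) := inferInstance
  haveI : Nonempty (Σ j : {j // j ∈ T}, (K j.1 →+* ℂ)) := ⟨⟨⟨j₁, hj₁⟩, s₁⟩⟩
  exact IrrOdd.typeRank_sigmaType_eq_iff_span_coeff_le_of_insert (G := ℂ ≃+* ℂ) (E := fun i => K i →+* ℂ)
    (Φ := fun i => (Φ i).1) (fun i => isCMTypeWith_conj (Φ i)) (· ∈ T) (· ∈ insert i T)
    (fun j => by rw [Finset.mem_insert]; exact Or.comm)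

/-- **THE LAST FACTOR: `cmFamilyRank Φ + 1 + dim(MC_{≠i} ∩ MC_i) = cmFamilyRank Φ|_{≠i} + cmTypeRank Φ_i`** (`|I| ≥ 2`).
[cite: Deligne1982HodgeCycles, I.5 (p. 53)] [cite: Gordon1999HodgeAVSurvey, §3 Theorem (proof), 7.5–7.7, 9.1] -/
theorem cmFamilyRank_add_one_add_finrank_inf_eq_erase [Nontrivial I] (Φ : ∀ i, CMType (K i)) (i : I) :
    CMAlgebra.cmFamilyRank Φ + 1 +
        Module.finrank ℚ
          ↥((⨆ j : {j // j ≠ i}, Submodule.span ℚ (Set.range fun x : K j.1 →+* ℂ => fun g : ℂ ≃+* ℂ =>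
              antiVec (Φ j.1).1 g x)) ⊓
            Submodule.span ℚ (Set.range fun x : K i →+* ℂ => fun g : ℂ ≃+* ℂ => antiVec (Φ i).1 g x)) =
      CMAlgebra.cmFamilyRank (fun j : {j // j ≠ i} => Φ j.1) + cmTypeRank (Φ i) := by
  obtain ⟨j₁, hj₁⟩ := exists_ne i
  obtain ⟨s₁⟩ : Nonempty (K j₁ →+* ℂ) := inferInstance
  haveI : Nonempty (Σ j : {j // j ≠ i}, (K j.1 →+* ℂ)) := ⟨⟨⟨j₁, hj₁⟩, s₁⟩⟩
  haveI : ∀ i, Nonempty (K i →+* ℂ) := fun i => inferInstance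
  exact IrrOdd.typeRank_sigmaType_add_one_add_finrank_inf_eq_of_erase (G := ℂ ≃+* ℂ) (E := fun i => K i →+* ℂ)
    (Φ := fun i => (Φ i).1) (fun i => isCMTypeWith_conj (Φ i)) i

/-- **`cmFamilyRank Φ = cmFamilyRank Φ|_{≠i} ⟺ MC_i ≤ MC_{≠i}`** (`|I| ≥ 2`): `A_i` is Hodge-dominated by the product of
all the other factors. [cite: Deligne1982HodgeCycles, I.5 (p. 53)] [cite: Gordon1999HodgeAVSurvey, §3 Theorem
(proof), 7.7] -/
theorem cmFamilyRank_eq_erase_iff_span_coeff_le [Nontrivial I] (Φ : ∀ i, CMType (K i)) (i : I) :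
    CMAlgebra.cmFamilyRank Φ = CMAlgebra.cmFamilyRank (fun j : {j // j ≠ i} => Φ j.1) ↔
      Submodule.span ℚ (Set.range fun x : K i →+* ℂ => fun g : ℂ ≃+* ℂ => antiVec (Φ i).1 g x) ≤
        ⨆ j : {j // j ≠ i}, Submodule.span ℚ (Set.range fun x : K j.1 →+* ℂ => fun g : ℂ ≃+* ℂ =>
          antiVec (Φ j.1).1 g x) := by
  obtain ⟨j₁, hj₁⟩ := exists_ne i
  obtain ⟨s₁⟩ : Nonempty (K j₁ →+* ℂ) := inferInstance
  haveI : Nonempty (Σ j : {j // j ≠ i}, (K j.1 →+* ℂ)) := ⟨⟨⟨j₁, hj₁⟩, s₁⟩⟩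
  exact IrrOdd.typeRank_sigmaType_eq_iff_span_coeff_le_of_erase (G := ℂ ≃+* ℂ) (E := fun i => K i →+* ℂ)
    (Φ := fun i => (Φ i).1) (fun i => isCMTypeWith_conj (Φ i)) i

/-! ### §2 In one isotypic class -/

/-- **`dim MT(∏_i A_i)` IN ONE ISOTYPIC CLASS: `cmFamilyRank Φ·δ = δ + dim(⨆_i D⟨b^i⟩)·dim A`** — all type vectors
`u_i = Σ_j ι^i_j(b^i_j)` assembled from ONE reference `Aut(ℂ)`-stable irreducible `A ≤ ℚ^Y` (commutant `𝒟`, ANY;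
`0 ≠ a₀ ∈ A` names `δ`): `dim Hg(∏_i A_i)·δ = dim(D-span of all the components)·dim A`.
[cite: Lang2002, XVII §3] [cite: Deligne1982HodgeCycles, I.5 (p. 53) and I Ex. 3.7 (c)] -/
theorem cmFamilyRank_mul_eq_of_commutant [Nonempty I] (Φ : ∀ i, CMType (K i))
    {A : Submodule ℚ (Y → ℚ)} {𝒟 : Submodule ℚ ((Y → ℚ) →ₗ[ℚ] (Y → ℚ))}
    (h𝒟 : ∀ L : (Y → ℚ) →ₗ[ℚ] (Y → ℚ), L ∈ 𝒟 ↔ (∀ a ∈ A, L a ∈ A) ∧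
      ∀ (k : ℂ ≃+* ℂ) (a : Y → ℚ), a ∈ A → L (fun y => a (k • y)) = fun y => L a (k • y))
    (hAst : ∀ (k : ℂ ≃+* ℂ) (a : Y → ℚ), a ∈ A → (fun y => a (k • y)) ∈ A)
    (hAirr : ∀ W : Submodule ℚ (Y → ℚ), W ≤ A → W ≠ ⊥ →
      (∀ (k : ℂ ≃+* ℂ) (f : Y → ℚ), f ∈ W → (fun y => f (k • y)) ∈ W) → W = A)
    {J : I → Type} [∀ i, Fintype (J i)] (ι : ∀ i, J i → ((Y → ℚ) →ₗ[ℚ] ((K i →+* ℂ) → ℚ)))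
    (hιeq : ∀ i (j : J i) (k : ℂ ≃+* ℂ) (a : Y → ℚ), a ∈ A → ι i j (fun y => a (k • y)) = fun y => ι i j a (k • y))
    (hind : ∀ i (f : J i → (Y → ℚ)), (∀ j, f j ∈ A) → ∑ j, ι i j (f j) = 0 → ∀ j, f j = 0)
    {b : ∀ i, J i → (Y → ℚ)} (hb : ∀ i j, b i j ∈ A)
    (hu : ∀ i, antiVec (Φ i).1 (1 : ℂ ≃+* ℂ) = ∑ j, ι i j (b i j)) {a₀ : Y → ℚ} (ha₀ : a₀ ∈ A) (h0 : a₀ ≠ 0) :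
    CMAlgebra.cmFamilyRank Φ * Module.finrank ℚ ↥(𝒟.map (LinearMap.applyₗ a₀)) =
      Module.finrank ℚ ↥(𝒟.map (LinearMap.applyₗ a₀)) +
        Module.finrank ℚ ↥(⨆ i, ⨆ j, 𝒟.map (LinearMap.applyₗ (b i j))) * Module.finrank ℚ A := by
  haveI : ∀ i, Nonempty (K i →+* ℂ) := fun i => inferInstance
  exact IrrOdd.typeRank_sigmaType_mul_eq_of_class (G := ℂ ≃+* ℂ) (E := fun i => K i →+* ℂ) (Φ := fun i => (Φ i).1)
    (fun i => isCMTypeWith_conj (Φ i)) h𝒟 hAst hAirr ι hιeq hind hb hu ha₀ h0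

/-- **THE FAMILY DEFECT IN ONE ISOTYPIC CLASS (CM fields): `(cmFamilyRank Φ + |I|)·δ + (Σ_i dim D⟨b^i⟩)·dim A =
(Σ_i cmTypeRank Φ_i + 1)·δ + dim(⨆_i D⟨b^i⟩)·dim A`** — `(Σ_i dim Hg(A_i) − dim Hg(∏_i A_i))·δ = (Σ_i dim D⟨b^i⟩ −
dim Σ_i D⟨b^i⟩)·dim A`. [cite: Deligne1982HodgeCycles, I Ex. 3.7 (c)] [cite: Gordon1999HodgeAVSurvey, 7.5–7.7]
[cite: Lang2002, XVII §3] -/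
theorem cmFamilyRank_add_card_mul_add_eq_of_commutant [Nonempty I] (Φ : ∀ i, CMType (K i))
    {A : Submodule ℚ (Y → ℚ)} {𝒟 : Submodule ℚ ((Y → ℚ) →ₗ[ℚ] (Y → ℚ))}
    (h𝒟 : ∀ L : (Y → ℚ) →ₗ[ℚ] (Y → ℚ), L ∈ 𝒟 ↔ (∀ a ∈ A, L a ∈ A) ∧
      ∀ (k : ℂ ≃+* ℂ) (a : Y → ℚ), a ∈ A → L (fun y => a (k • y)) = fun y => L a (k • y))
    (hAst : ∀ (k : ℂ ≃+* ℂ) (a : Y → ℚ), a ∈ A → (fun y => a (k • y)) ∈ A)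
    (hAirr : ∀ W : Submodule ℚ (Y → ℚ), W ≤ A → W ≠ ⊥ →
      (∀ (k : ℂ ≃+* ℂ) (f : Y → ℚ), f ∈ W → (fun y => f (k • y)) ∈ W) → W = A)
    {J : I → Type} [∀ i, Fintype (J i)] (ι : ∀ i, J i → ((Y → ℚ) →ₗ[ℚ] ((K i →+* ℂ) → ℚ)))
    (hιeq : ∀ i (j : J i) (k : ℂ ≃+* ℂ) (a : Y → ℚ), a ∈ A → ι i j (fun y => a (k • y)) = fun y => ι i j a (k • y))
    (hind : ∀ i (f : J i → (Y → ℚ)), (∀ j, f j ∈ A) → ∑ j, ι i j (f j) = 0 → ∀ j, f j = 0)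
    {b : ∀ i, J i → (Y → ℚ)} (hb : ∀ i j, b i j ∈ A)
    (hu : ∀ i, antiVec (Φ i).1 (1 : ℂ ≃+* ℂ) = ∑ j, ι i j (b i j)) {a₀ : Y → ℚ} (ha₀ : a₀ ∈ A) (h0 : a₀ ≠ 0) :
    (CMAlgebra.cmFamilyRank Φ + Fintype.card I) * Module.finrank ℚ ↥(𝒟.map (LinearMap.applyₗ a₀)) +
        (∑ i, Module.finrank ℚ ↥(⨆ j, 𝒟.map (LinearMap.applyₗ (b i j)))) * Module.finrank ℚ A =
      ((∑ i, cmTypeRank (Φ i)) + 1) * Module.finrank ℚ ↥(𝒟.map (LinearMap.applyₗ a₀)) +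
        Module.finrank ℚ ↥(⨆ i, ⨆ j, 𝒟.map (LinearMap.applyₗ (b i j))) * Module.finrank ℚ A := by
  haveI : ∀ i, Nonempty (K i →+* ℂ) := fun i => inferInstance
  exact IrrOdd.typeRank_sigmaType_add_card_mul_add_eq_of_class (G := ℂ ≃+* ℂ) (E := fun i => K i →+* ℂ)
    (Φ := fun i => (Φ i).1) (fun i => isCMTypeWith_conj (Φ i)) h𝒟 hAst hAirr ι hιeq hind hb hu ha₀ h0

/-- **ADDITIVITY IN ONE ISOTYPIC CLASS (CM fields): `Hg(∏_i A_i) = ∏_i Hg(A_i)` (`cmFamilyRank Φ + |I| =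
Σ_i cmTypeRank Φ_i + 1`) IFF the D-spans `D⟨b^i⟩` of the type components are INDEPENDENT in `A`** (`A ≠ 0`).
[cite: Gordon1999HodgeAVSurvey, §3 Theorem and 7.5–7.7] [cite: Lang2002, XVII §1 and §3] -/
theorem cmFamilyRank_add_card_eq_iff_iSupIndep_of_commutant [Nonempty I] (Φ : ∀ i, CMType (K i))
    {A : Submodule ℚ (Y → ℚ)} {𝒟 : Submodule ℚ ((Y → ℚ) →ₗ[ℚ] (Y → ℚ))}
    (h𝒟 : ∀ L : (Y → ℚ) →ₗ[ℚ] (Y → ℚ), L ∈ 𝒟 ↔ (∀ a ∈ A, L a ∈ A) ∧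
      ∀ (k : ℂ ≃+* ℂ) (a : Y → ℚ), a ∈ A → L (fun y => a (k • y)) = fun y => L a (k • y))
    (hAst : ∀ (k : ℂ ≃+* ℂ) (a : Y → ℚ), a ∈ A → (fun y => a (k • y)) ∈ A)
    (hAirr : ∀ W : Submodule ℚ (Y → ℚ), W ≤ A → W ≠ ⊥ →
      (∀ (k : ℂ ≃+* ℂ) (f : Y → ℚ), f ∈ W → (fun y => f (k • y)) ∈ W) → W = A)
    (hA0 : A ≠ ⊥) {J : I → Type} [∀ i, Fintype (J i)] (ι : ∀ i, J i → ((Y → ℚ) →ₗ[ℚ] ((K i →+* ℂ) → ℚ)))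
    (hιeq : ∀ i (j : J i) (k : ℂ ≃+* ℂ) (a : Y → ℚ), a ∈ A → ι i j (fun y => a (k • y)) = fun y => ι i j a (k • y))
    (hind : ∀ i (f : J i → (Y → ℚ)), (∀ j, f j ∈ A) → ∑ j, ι i j (f j) = 0 → ∀ j, f j = 0)
    {b : ∀ i, J i → (Y → ℚ)} (hb : ∀ i j, b i j ∈ A)
    (hu : ∀ i, antiVec (Φ i).1 (1 : ℂ ≃+* ℂ) = ∑ j, ι i j (b i j)) :
    CMAlgebra.cmFamilyRank Φ + Fintype.card I = (∑ i, cmTypeRank (Φ i)) + 1 ↔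
      iSupIndep fun i => ⨆ j, 𝒟.map (LinearMap.applyₗ (b i j)) := by
  haveI : ∀ i, Nonempty (K i →+* ℂ) := fun i => inferInstance
  exact IrrOdd.typeRank_sigmaType_add_card_eq_iff_iSupIndep_of_class (G := ℂ ≃+* ℂ) (E := fun i => K i →+* ℂ)
    (Φ := fun i => (Φ i).1) (fun i => isCMTypeWith_conj (Φ i)) h𝒟 hAst hAirr hA0 ι hιeq hind hb hu

/-- **SUB-PRODUCT DOMINATION IN ONE ISOTYPIC CLASS (CM fields): `cmFamilyRank Φ = cmFamilyRank Φ|_T ⟺ ∀ i,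
D⟨b^i⟩ ≤ ⨆_{j∈T} D⟨b^j⟩`** (`T ≠ ∅`, `A ≠ 0`) — every factor is Hodge-dominated by `∏_T A_j` iff its type components
are `D`-combinations of those of the factors in `T`. [cite: Deligne1982HodgeCycles, I.5 (p. 53)]
[cite: Gordon1999HodgeAVSurvey, §3 Theorem (proof), 7.5–7.7 and 9.4.3] [cite: Lang2002, XVII §3] -/
theorem cmFamilyRank_eq_restrict_iff_forall_iSup_le_of_commutant (Φ : ∀ i, CMType (K i)) (T : Finset I)
    (hT : T.Nonempty) {A : Submodule ℚ (Y → ℚ)} {𝒟 : Submodule ℚ ((Y → ℚ) →ₗ[ℚ] (Y → ℚ))}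
    (h𝒟 : ∀ L : (Y → ℚ) →ₗ[ℚ] (Y → ℚ), L ∈ 𝒟 ↔ (∀ a ∈ A, L a ∈ A) ∧
      ∀ (k : ℂ ≃+* ℂ) (a : Y → ℚ), a ∈ A → L (fun y => a (k • y)) = fun y => L a (k • y))
    (hAst : ∀ (k : ℂ ≃+* ℂ) (a : Y → ℚ), a ∈ A → (fun y => a (k • y)) ∈ A)
    (hAirr : ∀ W : Submodule ℚ (Y → ℚ), W ≤ A → W ≠ ⊥ →
      (∀ (k : ℂ ≃+* ℂ) (f : Y → ℚ), f ∈ W → (fun y => f (k • y)) ∈ W) → W = A)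
    (hA0 : A ≠ ⊥) {J : I → Type} [∀ i, Fintype (J i)] (ι : ∀ i, J i → ((Y → ℚ) →ₗ[ℚ] ((K i →+* ℂ) → ℚ)))
    (hιeq : ∀ i (j : J i) (k : ℂ ≃+* ℂ) (a : Y → ℚ), a ∈ A → ι i j (fun y => a (k • y)) = fun y => ι i j a (k • y))
    (hind : ∀ i (f : J i → (Y → ℚ)), (∀ j, f j ∈ A) → ∑ j, ι i j (f j) = 0 → ∀ j, f j = 0)
    {b : ∀ i, J i → (Y → ℚ)} (hb : ∀ i j, b i j ∈ A)
    (hu : ∀ i, antiVec (Φ i).1 (1 : ℂ ≃+* ℂ) = ∑ j, ι i j (b i j)) :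
    CMAlgebra.cmFamilyRank Φ = CMAlgebra.cmFamilyRank (fun j : T => Φ j.1) ↔
      ∀ i, (⨆ j, 𝒟.map (LinearMap.applyₗ (b i j))) ≤ ⨆ j' : T, ⨆ j, 𝒟.map (LinearMap.applyₗ (b j'.1 j)) := by
  haveI : Nonempty {j // j ∈ T} := hT.coe_sort
  haveI : ∀ i, Nonempty (K i →+* ℂ) := fun i => inferInstance
  exact IrrOdd.typeRank_sigmaType_eq_reindex_iff_forall_iSup_le_of_class (G := ℂ ≃+* ℂ) (E := fun i => K i →+* ℂ)
    (Φ := fun i => (Φ i).1) (fun i => isCMTypeWith_conj (Φ i)) (Subtype.val : {j // j ∈ T} → I) h𝒟 hAst hAirr hA0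
    ι hιeq hind hb hu

/-- **THE LAST FACTOR IN ONE ISOTYPIC CLASS (CM fields): `cmFamilyRank Φ = cmFamilyRank Φ|_{≠i₀} ⟺ D⟨b^{i₀}⟩ ≤
⨆_{i≠i₀} D⟨b^i⟩`** (`|I| ≥ 2`, `A ≠ 0`): `A_{i₀}` is Hodge-dominated by the product of the others iff its components are
`D`-combinations of theirs. [cite: Deligne1982HodgeCycles, I.5 (p. 53)] [cite: Gordon1999HodgeAVSurvey, §3 Theorem
(proof), 7.5–7.7] [cite: Lang2002, XVII §3] -/
theorem cmFamilyRank_eq_erase_iff_iSup_le_of_commutant [Nontrivial I] (Φ : ∀ i, CMType (K i)) (i₀ : I)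
    {A : Submodule ℚ (Y → ℚ)} {𝒟 : Submodule ℚ ((Y → ℚ) →ₗ[ℚ] (Y → ℚ))}
    (h𝒟 : ∀ L : (Y → ℚ) →ₗ[ℚ] (Y → ℚ), L ∈ 𝒟 ↔ (∀ a ∈ A, L a ∈ A) ∧
      ∀ (k : ℂ ≃+* ℂ) (a : Y → ℚ), a ∈ A → L (fun y => a (k • y)) = fun y => L a (k • y))
    (hAst : ∀ (k : ℂ ≃+* ℂ) (a : Y → ℚ), a ∈ A → (fun y => a (k • y)) ∈ A)
    (hAirr : ∀ W : Submodule ℚ (Y → ℚ), W ≤ A → W ≠ ⊥ →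
      (∀ (k : ℂ ≃+* ℂ) (f : Y → ℚ), f ∈ W → (fun y => f (k • y)) ∈ W) → W = A)
    (hA0 : A ≠ ⊥) {J : I → Type} [∀ i, Fintype (J i)] (ι : ∀ i, J i → ((Y → ℚ) →ₗ[ℚ] ((K i →+* ℂ) → ℚ)))
    (hιeq : ∀ i (j : J i) (k : ℂ ≃+* ℂ) (a : Y → ℚ), a ∈ A → ι i j (fun y => a (k • y)) = fun y => ι i j a (k • y))
    (hind : ∀ i (f : J i → (Y → ℚ)), (∀ j, f j ∈ A) → ∑ j, ι i j (f j) = 0 → ∀ j, f j = 0)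
    {b : ∀ i, J i → (Y → ℚ)} (hb : ∀ i j, b i j ∈ A)
    (hu : ∀ i, antiVec (Φ i).1 (1 : ℂ ≃+* ℂ) = ∑ j, ι i j (b i j)) :
    CMAlgebra.cmFamilyRank Φ = CMAlgebra.cmFamilyRank (fun j : {j // j ≠ i₀} => Φ j.1) ↔
      (⨆ j, 𝒟.map (LinearMap.applyₗ (b i₀ j))) ≤
        ⨆ j' : {j // j ≠ i₀}, ⨆ j, 𝒟.map (LinearMap.applyₗ (b j'.1 j)) := by
  obtain ⟨j₁, hj₁⟩ := exists_ne i₀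
  haveI : Nonempty {j // j ≠ i₀} := ⟨⟨j₁, hj₁⟩⟩
  haveI : ∀ i, Nonempty (K i →+* ℂ) := fun i => inferInstance
  exact IrrOdd.typeRank_sigmaType_eq_iff_iSup_le_of_erase_of_class (G := ℂ ≃+* ℂ) (E := fun i => K i →+* ℂ)
    (Φ := fun i => (Φ i).1) (fun i => isCMTypeWith_conj (Φ i)) i₀ h𝒟 hAst hAirr hA0 ι hιeq hind hb hu

end Summit.HodgeConjecture.CorCM

end
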